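import Literature.Analysis.OperatorTheory.Enflo2023.Lemma1
import Literature.Analysis.OperatorTheory.Enflo2023.EndToEnd
import HarnessLib

/-!
# Enflo (2023), v2 pp.1–2 and p.7: the manuscript's START is a theorem for every operator

Source: P. H. Enflo, *On the invariant subspace problem in Hilbert spaces*, arXiv:2305.15442v2 — a CLAIMED result
under adjudication (b2b-enflo repair cell, formaliser 1: Part A).  This file records what FOLLOWS; it does not
endorse the main theorem.  BLOCK-2b value: certificate / precise gap, not summit progress.

The Part-B modules take Part A's output as a HYPOTHESIS BLOCK "standing data at `y₁'`" (`EndToEnd.exists_state_of_partA`,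
`EndToEnd.nis_of_partA_and_claim`, `ClaimRun`'s `nis_of_partA_and_claimRun`, and the `∃ x₀ y₀ u₀ …` clause of
`EndToEnd.PartBResidualRun`): `‖x₀‖ = 1`, `0.3 + 2.2(εθ)₀ ≤ ‖x₀ − y₁'‖ ≤ 0.7`, `(εθ)₀ ∈ [0, 10⁻⁴]` real, (9) at
`y₁'`, the cone `Re⟨u₀, y₁'⟩ ≥ ‖y₁'‖/100`.  Here that block is DISCHARGED from the manuscript's own data:

* `standing_form` — the WLOG of v2 pp.1–2 completed for Part A's needs: for EVERY bounded operator `T` on an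
  infinite-dimensional Hilbert space, either `T` has a non-trivial closed invariant subspace outright (scalar,
  non-injective, or non-dense range after the spectral shift), or some `T' = c(T − μ)` with the same closed invariant
  subspaces has `‖T'‖ = 10⁻²⁰`, dense range, is injective and is NOT onto (`0 ∈ σ(T')` + injective + dense ⇒ not
  onto, by the open mapping theorem: `not_surjective_of_zero_mem_spectrum`).  "`R(T) ≠ H`" is exactly what the
  sharpened p.7 choice of `u₁` needs (`Lemma1.exists_unit_orthogonal_adjoint_le`).
* `exists_standing_data` — for `‖T‖ ≤ 1/10`, an orthonormal pair `u₀, u₁` with `‖T*u₁‖ ≤ t/4`, `0 < t ≤ 10⁻⁴`: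
  the Lemma-1 minimiser `y₁' = V_{y₀'}ℓ'_ε` (`Lemma1.partA_entry_data`) satisfies the standing block with
  `(εθ)₀ ≤ t`, for `x₀ = (√3/2)u₀ + ½u₁`.
* `exists_state_from_start`, `exists_state_from_standing` — hence Part B's certified START STATE
  (`MCStep.State`, with `(εθ) ∈ (0, 1.12t]`, `y ∈ Adm u₀`, (9), a Case-I index and the start control (33)) is
  reached from the p.7 data, resp. from the p.1 standing hypotheses and any unit `u₀`.
* `start_state_of_any` — composition with `standing_form`: for EVERY operator on an infinite-dimensional Hilbert
  space and every tolerance `t ∈ (0, 10⁻⁴]`, either a non-trivial closed invariant subspace, or an equivalent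
  normalised `T'` together with the manuscript's `u₀ ⟂ u₁`, `x₀`, `y₁'` and a certified Main-Construction start
  state of quality `t`.  So in the cell's end-to-end records the Part-A clause is never the obstruction: what remains
  is Part B's step claim alone.

Origin: planner-b2b-enflo-1-g9-0 (formaliser 1, gen 9), 2026-08-19.
-/

noncomputable section

open scoped InnerProductSpace
open Filter Topology ContinuousLinearMap

namespace Literature.Analysis.OperatorTheory.Enflo2023

namespace PartAStart

open Vy Lemma1

variable {H : Type*} [NormedAddCommGroup H] [InnerProductSpace ℂ H] [CompleteSpace H]

/-! ### WLOG (v2 pp.1–2): `‖T‖ = 10⁻²⁰`, `R(T)` dense, `T` injective, `R(T) ≠ H` -/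

/-- A bijective bounded operator on a Banach space is a unit (open mapping theorem). [folklore] -/
lemma isUnit_of_bijective (T : H →L[ℂ] H) (hinj : Function.Injective T) (hsurj : Function.Surjective T) :
    IsUnit T := by
  let e : H ≃L[ℂ] H := ContinuousLinearEquiv.ofBijective T (LinearMap.ker_eq_bot.mpr hinj)
    (LinearMap.range_eq_top.mpr hsurj)
  refine ⟨⟨T, (e.symm : H →L[ℂ] H), ?_, ?_⟩, rfl⟩
  · ext x
    simp [e, ContinuousLinearEquiv.ofBijective_apply_symm_apply]
  · ext x
    simp [e, ContinuousLinearEquiv.ofBijective_symm_apply_apply]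

/-- `0 ∈ σ(T)` and `T` injective ⟹ `T` is not onto (v2 p.1: "`R(T)` is dense but `R(T) ≠ H`"). [cite: Enflo2023, v2 p.1 (standing hypotheses)] -/
theorem not_surjective_of_zero_mem_spectrum (T : H →L[ℂ] H) (h0 : (0 : ℂ) ∈ spectrum ℂ T)
    (hinj : Function.Injective T) : ¬ Function.Surjective T := fun hsurj =>
  (spectrum.zero_mem_iff ℂ).mp h0 (isUnit_of_bijective T hinj hsurj)

omit [CompleteSpace H] in
/-- Units are unchanged by non-zero scalars. [folklore] -/
lemma isUnit_smul_iff {c : ℂ} (hc : c ≠ 0) (T : H →L[ℂ] H) : IsUnit (c • T) ↔ IsUnit T := by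
  obtain ⟨u, hu⟩ := (isUnit_iff_ne_zero.mpr hc).map (algebraMap ℂ (H →L[ℂ] H))
  rw [Algebra.smul_def, ← hu, Units.isUnit_units_mul]

omit [CompleteSpace H] in
/-- Injectivity is unchanged by non-zero scalars. [folklore] -/
lemma injective_of_injective_smul {c : ℂ} (T : H →L[ℂ] H) (h : Function.Injective (c • T)) :
    Function.Injective T := by
  intro x y hxy
  apply h
  change c • T x = c • T y
  rw [hxy]

omit [CompleteSpace H] in
/-- The range of `c • T` (`c ≠ 0`) is the range of `T`. [folklore] -/
lemma range_smul_eq {c : ℂ} (hc : c ≠ 0) (T : H →L[ℂ] H) : Set.range (c • T) = Set.range T := by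
  ext y
  constructor
  · rintro ⟨x, rfl⟩
    exact ⟨c • x, by simp [map_smul]⟩
  · rintro ⟨x, rfl⟩
    exact ⟨c⁻¹ • x, by simp [map_smul, smul_smul, inv_mul_cancel₀ hc]⟩

omit [CompleteSpace H] in
/-- Dense range in the `Submodule` language of `Reductions`. [folklore] -/
lemma topologicalClosure_range_eq_top_of_denseRange (T : H →L[ℂ] H) (h : DenseRange T) :
    (LinearMap.range (T : H →ₗ[ℂ] H)).topologicalClosure = ⊤ := by
  rw [← Submodule.dense_iff_topologicalClosure_eq_top, LinearMap.coe_range]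
  exact h

omit [CompleteSpace H] in
/-- Conversely: full closure of the range in the `Submodule` language gives dense range. [folklore] -/
lemma denseRange_of_topologicalClosure_range_eq_top (T : H →L[ℂ] H)
    (h : (LinearMap.range (T : H →ₗ[ℂ] H)).topologicalClosure = ⊤) : DenseRange T := by
  rw [← Submodule.dense_iff_topologicalClosure_eq_top, LinearMap.coe_range] at h
  exact h

/-- **The standing form of v2 pp.1–2, completed.**  On an infinite-dimensional Hilbert space, every bounded `T`
either has a non-trivial closed invariant subspace outright, or is equivalent (same closed invariant subspaces) to
a `T'` with `‖T'‖ = 10⁻²⁰`, dense range, injective and NOT onto.  (Spectral shift `T − μ` with `0 ∈ σ`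
(`wlog_zero_mem_spectrum`), scaling (`wlog_opNorm`), kernel / closure-of-range reductions (`Reductions`), and the
open mapping theorem.) [cite: Enflo2023, v2 pp.1–2 (standing hypotheses: σ(T) ≠ ∅, λI + μT, ‖T‖ = 10⁻²⁰, R(T) dense, R(T) ≠ H)] -/
theorem standing_form (hH : ¬ FiniteDimensional ℂ H) (T : H →L[ℂ] H) :
    HasNontrivialClosedInvariantSubspace T ∨
      ∃ T' : H →L[ℂ] H, ‖T'‖ = 1e-20 ∧ DenseRange T' ∧ Function.Injective T' ∧ ¬ Function.Surjective T' ∧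
        (HasNontrivialClosedInvariantSubspace T' → HasNontrivialClosedInvariantSubspace T) := by
  have hN : Nontrivial H := by
    by_contra h
    rw [not_nontrivial_iff_subsingleton] at h
    exact hH (Module.Finite.of_surjective (0 : (Fin 0 → ℂ) →ₗ[ℂ] H) fun x => ⟨0, Subsingleton.elim _ _⟩)
  obtain ⟨μ, h0, hiff⟩ := wlog_zero_mem_spectrum T
  by_cases h1 : T - μ • (1 : H →L[ℂ] H) = 0
  · left
    rw [← hiff, h1]
    exact EndToEnd.nis_zero hH
  obtain ⟨hnorm, hiff2⟩ := wlog_opNorm (T - μ • (1 : H →L[ℂ] H)) h1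
  have hc : ((((1e-20 : ℝ) / ‖T - μ • (1 : H →L[ℂ] H)‖ : ℝ) : ℂ)) ≠ 0 := by
    exact_mod_cast div_ne_zero (by norm_num) (norm_ne_zero_iff.mpr h1)
  have hT0 : (((1e-20 : ℝ) / ‖T - μ • (1 : H →L[ℂ] H)‖ : ℝ) : ℂ) • (T - μ • (1 : H →L[ℂ] H)) ≠ 0 :=
    smul_ne_zero hc h1
  by_cases hinj : Function.Injective
      ((((1e-20 : ℝ) / ‖T - μ • (1 : H →L[ℂ] H)‖ : ℝ) : ℂ) • (T - μ • (1 : H →L[ℂ] H)))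
  swap
  · left
    exact hiff.mp (hiff2.mp (hasNontrivialClosedInvariantSubspace_of_not_injective _ hinj hT0))
  by_cases hdense : DenseRange
      ((((1e-20 : ℝ) / ‖T - μ • (1 : H →L[ℂ] H)‖ : ℝ) : ℂ) • (T - μ • (1 : H →L[ℂ] H)))
  swap
  · left
    refine hiff.mp (hiff2.mp (hasNontrivialClosedInvariantSubspace_of_range_not_dense _ ?_ hT0))
    exact fun h => hdense (denseRange_of_topologicalClosure_range_eq_top _ h)
  right
  refine ⟨_, hnorm, hdense, hinj, ?_, fun h => hiff.mp (hiff2.mp h)⟩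
  refine not_surjective_of_zero_mem_spectrum _ ?_ hinj
  rw [spectrum.zero_mem_iff] at h0 ⊢
  exact fun hu => h0 ((isUnit_smul_iff hc _).mp hu)

/-! ### The manuscript's start data (p.7 + Lemma 1) in the shape Part B's entry consumes -/

/-- **The standing block at `y₁'` is a theorem.**  For `‖T‖ ≤ 1/10`, an orthonormal pair with `‖T*u₁‖ ≤ t/4`,
`0 < t ≤ 10⁻⁴`, and `x₀ = (√3/2)u₀ + ½u₁`: the Lemma-1 minimiser `y₁' = V_{y₀'}ℓ'_ε` has `‖x₀‖ = 1`,
`0.3 + 2.2(εθ)₀ ≤ ‖x₀ − y₁'‖ ≤ 0.7` (indeed `‖x₀ − y₁'‖ = ε ∈ [½ − 2t, ½]`), `(εθ)₀` real with `0 ≤ (εθ)₀ ≤ t`,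
(9) at `y₁'` for every power, and the cone `Re⟨u₀, y₁'⟩ ≥ ‖y₁'‖/100` — every hypothesis of
`EndToEnd.exists_state_of_partA`. [cite: Enflo2023, v2 p.7 (choice of x₀, u₁), pp.8–9 Lemma 1, p.9 "we now start (26)"] -/
theorem exists_standing_data (T : H →L[ℂ] H) (hT : ‖T‖ < 1) (hT10 : ‖T‖ ≤ 1 / 10) (u₀ u₁ : H)
    (hu₀ : ‖u₀‖ = 1) (hu₁ : ‖u₁‖ = 1) (h01 : ⟪u₀, u₁⟫_ℂ = 0) {t : ℝ} (ht0 : 0 < t) (ht1 : t ≤ 1 / 10 ^ 4)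
    (hη : ‖adjoint T u₁‖ ≤ t / 4) :
    ∃ y₀ : H, ‖xStart u₀ u₁‖ = 1 ∧
      (0.3 + 2.2 * (⟪xStart u₀ u₁ - y₀, y₀⟫_ℂ).re ≤ ‖xStart u₀ u₁ - y₀‖ ∧ ‖xStart u₀ u₁ - y₀‖ ≤ 0.7) ∧
      (⟪xStart u₀ u₁ - y₀, y₀⟫_ℂ).im = 0 ∧
      0 ≤ (⟪xStart u₀ u₁ - y₀, y₀⟫_ℂ).re ∧
      (⟪xStart u₀ u₁ - y₀, y₀⟫_ℂ).re ≤ t ∧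
      (∀ m : ℕ, ‖⟪xStart u₀ u₁ - y₀, (T ^ m) y₀⟫_ℂ‖ ≤ (⟪xStart u₀ u₁ - y₀, y₀⟫_ℂ).re) ∧
      ‖u₀‖ ≤ 1 ∧ ‖y₀‖ / 100 ≤ (⟪u₀, y₀⟫_ℂ).re ∧
      ∃ (ε : ℝ) (a : ℓ2), 1 / 2 - 2 * t ≤ ε ∧ ε ≤ 1 / 2 ∧
        IsMinimal (V T hT (yStart u₀)) (xStart u₀ u₁) ε a ∧ y₀ = V T hT (yStart u₀) a := by
  have ht1' : t ≤ 1 / 100 := ht1.trans (by norm_num)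
  obtain ⟨ε, a, h1, h2, ha, hn, him, hθ0, hθ, h9, -, hcone⟩ :=
    partA_entry_data T hT hT10 u₀ u₁ hu₀ hu₁ h01 ht0 ht1' hη
  refine ⟨V T hT (yStart u₀) a, norm_xStart u₀ u₁ hu₀ hu₁ h01, ⟨?_, ?_⟩, him, hθ0, hθ, h9, hu₀.le, hcone,
    ε, a, h1, h2, ha, rfl⟩
  · rw [hn]; nlinarith
  · rw [hn]; linarith

/-- **Part B's start state from the p.7 data.**  `‖T‖ ≤ 10⁻²⁰`, an orthonormal pair with `‖T*u₁‖ ≤ t/4`,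
`0 < t ≤ 10⁻⁴`: either `T` has a non-trivial closed invariant subspace, or the Main Construction has a certified
start state `s` (`MCStep.State T x₀ Vy.S`, `x₀ = (√3/2)u₀ + ½u₁`) at a Case-I exit `y` of the (26)-run from the
Lemma-1 vector `y₁'`: `(εθ) ∈ (0, 1.12t]` real, `‖y − y₁'‖ ≤ 2.2t`, `y ∈ Adm u₀`, (9), a Case-I index, and the
start control (33) in kernel form. [cite: Enflo2023, v2 p.7, pp.8–9 Lemma 1, p.13 (26), p.15 (33), p.17 l.578] -/
theorem exists_state_from_start (T : H →L[ℂ] H) (hT : ‖T‖ < 1) (hT20 : ‖T‖ ≤ 1 / 10 ^ 20) (u₀ u₁ : H)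
    (hu₀ : ‖u₀‖ = 1) (hu₁ : ‖u₁‖ = 1) (h01 : ⟪u₀, u₁⟫_ℂ = 0) {t : ℝ} (ht0 : 0 < t) (ht1 : t ≤ 1 / 10 ^ 4)
    (hη : ‖adjoint T u₁‖ ≤ t / 4) :
    HasNontrivialClosedInvariantSubspace T ∨
      ∃ (y₀ y : H) (s : MCStep.State T (xStart u₀ u₁) Vy.S),
        (∃ (ε : ℝ) (a : ℓ2), 1 / 2 - 2 * t ≤ ε ∧ ε ≤ 1 / 2 ∧
          IsMinimal (V T hT (yStart u₀)) (xStart u₀ u₁) ε a ∧ y₀ = V T hT (yStart u₀) a)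
        ∧ (⟪xStart u₀ u₁ - y₀, y₀⟫_ℂ).re ≤ t
        ∧ s.V = V T hT y ∧ s.ε = ‖xStart u₀ u₁ - y‖
        ∧ 0 < (⟪xStart u₀ u₁ - y, y⟫_ℂ).re
        ∧ (⟪xStart u₀ u₁ - y, y⟫_ℂ).im = 0
        ∧ (⟪xStart u₀ u₁ - y, y⟫_ℂ).re ≤ 1.12 * t
        ∧ ‖y - y₀‖ ≤ 2.2 * t
        ∧ y ∈ Lemma2.Adm u₀
        ∧ (∀ m : ℕ, ‖⟪xStart u₀ u₁ - y, (T ^ m) y⟫_ℂ‖ ≤ (⟪xStart u₀ u₁ - y, y⟫_ℂ).re)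
        ∧ (∃ j, 1 ≤ j ∧ (⟪xStart u₀ u₁ - y, y⟫_ℂ).re ^ 4 < ‖⟪xStart u₀ u₁ - y, (T ^ j) y⟫_ℂ‖)
        ∧ 1 - Lemma2.gammaEps T hT u₀ (⟪xStart u₀ u₁ - y, y⟫_ℂ).re ≤ ‖s.a 0‖ ^ 2
        ∧ ‖s.a 0‖ ^ 2 ≤ 1 - (98 / 100 * 10 ^ 20 * (⟪xStart u₀ u₁ - y, y⟫_ℂ).re ^ 11) ^ 2
        ∧ (98 / 100 * 10 ^ 20 * (⟪xStart u₀ u₁ - y, y⟫_ℂ).re ^ 11) ^ 2 ≤ ‖L s.a‖ ^ 2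
        ∧ ‖L s.a‖ ^ 2 ≤ Lemma2.gammaEps T hT u₀ (⟪xStart u₀ u₁ - y, y⟫_ℂ).re
        ∧ (1 - Lemma2.gammaEps T hT u₀ (⟪xStart u₀ u₁ - y, y⟫_ℂ).re) * ‖s.a‖ ^ 2 ≤ ‖s.a 0‖ ^ 2 := by
  have hT10 : ‖T‖ ≤ 1 / 10 := hT20.trans (by norm_num)
  obtain ⟨y₀, hx₀, hwin, him, hθ0, hθ, h9, hu₀', hcone, hmin⟩ :=
    exists_standing_data T hT hT10 u₀ u₁ hu₀ hu₁ h01 ht0 ht1 hη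
  rcases EndToEnd.exists_state_of_partA T hT hT20 (xStart u₀ u₁) y₀ u₀ hx₀ hwin him hθ0 (hθ.trans ht1) h9
      hu₀' hcone with hnis | ⟨y, s, hV, hε, hpos, hreal, hup, hdist, hAdm, h9', hI, h33a, h33b, h33c, h33d, h33e⟩
  · exact Or.inl hnis
  · refine Or.inr ⟨y₀, y, s, hmin, hθ, hV, hε, hpos, hreal, ?_, ?_, hAdm, h9', hI, h33a, h33b, h33c, h33d, h33e⟩
    · exact hup.trans (by nlinarith)
    · exact hdist.trans (by nlinarith)

/-- **Part B's start state from the p.1 standing hypotheses.**  `‖T‖ ≤ 10⁻²⁰`, `R(T)` dense, `R(T) ≠ H`, any unit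
`u₀`, `0 < t ≤ 10⁻⁴`: the sharpened p.7 vector `u₁` exists (`Lemma1.exists_unit_orthogonal_adjoint_le`) and
`exists_state_from_start` applies. [cite: Enflo2023, v2 p.1 (standing hypotheses), p.7, pp.8–9, p.17 l.578] -/
theorem exists_state_from_standing (T : H →L[ℂ] H) (hT : ‖T‖ < 1) (hT20 : ‖T‖ ≤ 1 / 10 ^ 20)
    (hdense : DenseRange T) (hsurj : ¬ Function.Surjective T) (u₀ : H) (hu₀ : ‖u₀‖ = 1)
    {t : ℝ} (ht0 : 0 < t) (ht1 : t ≤ 1 / 10 ^ 4) :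
    ∃ u₁ : H, ‖u₁‖ = 1 ∧ ⟪u₀, u₁⟫_ℂ = 0 ∧ ‖adjoint T u₁‖ ≤ t / 4 ∧
    (HasNontrivialClosedInvariantSubspace T ∨
      ∃ (y₀ y : H) (s : MCStep.State T (xStart u₀ u₁) Vy.S),
        (∃ (ε : ℝ) (a : ℓ2), 1 / 2 - 2 * t ≤ ε ∧ ε ≤ 1 / 2 ∧
          IsMinimal (V T hT (yStart u₀)) (xStart u₀ u₁) ε a ∧ y₀ = V T hT (yStart u₀) a)
        ∧ (⟪xStart u₀ u₁ - y₀, y₀⟫_ℂ).re ≤ t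
        ∧ s.V = V T hT y ∧ s.ε = ‖xStart u₀ u₁ - y‖
        ∧ 0 < (⟪xStart u₀ u₁ - y, y⟫_ℂ).re
        ∧ (⟪xStart u₀ u₁ - y, y⟫_ℂ).im = 0
        ∧ (⟪xStart u₀ u₁ - y, y⟫_ℂ).re ≤ 1.12 * t
        ∧ ‖y - y₀‖ ≤ 2.2 * t
        ∧ y ∈ Lemma2.Adm u₀
        ∧ (∀ m : ℕ, ‖⟪xStart u₀ u₁ - y, (T ^ m) y⟫_ℂ‖ ≤ (⟪xStart u₀ u₁ - y, y⟫_ℂ).re)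
        ∧ (∃ j, 1 ≤ j ∧ (⟪xStart u₀ u₁ - y, y⟫_ℂ).re ^ 4 < ‖⟪xStart u₀ u₁ - y, (T ^ j) y⟫_ℂ‖)
        ∧ 1 - Lemma2.gammaEps T hT u₀ (⟪xStart u₀ u₁ - y, y⟫_ℂ).re ≤ ‖s.a 0‖ ^ 2
        ∧ ‖s.a 0‖ ^ 2 ≤ 1 - (98 / 100 * 10 ^ 20 * (⟪xStart u₀ u₁ - y, y⟫_ℂ).re ^ 11) ^ 2
        ∧ (98 / 100 * 10 ^ 20 * (⟪xStart u₀ u₁ - y, y⟫_ℂ).re ^ 11) ^ 2 ≤ ‖L s.a‖ ^ 2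
        ∧ ‖L s.a‖ ^ 2 ≤ Lemma2.gammaEps T hT u₀ (⟪xStart u₀ u₁ - y, y⟫_ℂ).re
        ∧ (1 - Lemma2.gammaEps T hT u₀ (⟪xStart u₀ u₁ - y, y⟫_ℂ).re) * ‖s.a‖ ^ 2 ≤ ‖s.a 0‖ ^ 2) := by
  obtain ⟨u₁, hu₁, h01, hη⟩ :=
    exists_unit_orthogonal_adjoint_le T hdense hsurj u₀ hu₀ (η := t / 4) (by linarith)
  exact ⟨u₁, hu₁, h01, hη, exists_state_from_start T hT hT20 u₀ u₁ hu₀ hu₁ h01 ht0 ht1 hη⟩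

/-- **For EVERY operator: invariant subspace outright, or the manuscript's certified start.**  On an
infinite-dimensional Hilbert space and for every tolerance `t ∈ (0, 10⁻⁴]`: either `T` has a non-trivial closed
invariant subspace, or some `T'` with the same closed invariant subspaces (`‖T'‖ = 10⁻²⁰`, dense range, injective,
not onto) admits the manuscript's data — an orthonormal pair `u₀, u₁` with `‖T'*u₁‖ ≤ t/4`, the Lemma-1 vector
`y₁'` with the standing block at level `≤ t`, and a certified Main-Construction start state with (33).  What the
manuscript still has to supply from here is Part B's step claim only. [cite: Enflo2023, v2 pp.1–2, p.7, pp.8–9 Lemma 1, p.13 (26), p.15 (33), p.17 l.578] -/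
theorem start_state_of_any (hH : ¬ FiniteDimensional ℂ H) (T : H →L[ℂ] H) {t : ℝ} (ht0 : 0 < t)
    (ht1 : t ≤ 1 / 10 ^ 4) :
    HasNontrivialClosedInvariantSubspace T ∨
      ∃ (T' : H →L[ℂ] H) (hT' : ‖T'‖ < 1) (u₀ u₁ y₀ y : H) (s : MCStep.State T' (xStart u₀ u₁) Vy.S),
        ‖T'‖ = 1e-20 ∧ DenseRange T' ∧ Function.Injective T' ∧ ¬ Function.Surjective T'
        ∧ (HasNontrivialClosedInvariantSubspace T' → HasNontrivialClosedInvariantSubspace T)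
        ∧ ‖u₀‖ = 1 ∧ ‖u₁‖ = 1 ∧ ⟪u₀, u₁⟫_ℂ = 0 ∧ ‖adjoint T' u₁‖ ≤ t / 4
        ∧ (∃ (ε : ℝ) (a : ℓ2), 1 / 2 - 2 * t ≤ ε ∧ ε ≤ 1 / 2 ∧
            IsMinimal (V T' hT' (yStart u₀)) (xStart u₀ u₁) ε a ∧ y₀ = V T' hT' (yStart u₀) a)
        ∧ (⟪xStart u₀ u₁ - y₀, y₀⟫_ℂ).re ≤ t
        ∧ s.V = V T' hT' y ∧ s.ε = ‖xStart u₀ u₁ - y‖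
        ∧ 0 < (⟪xStart u₀ u₁ - y, y⟫_ℂ).re
        ∧ (⟪xStart u₀ u₁ - y, y⟫_ℂ).im = 0
        ∧ (⟪xStart u₀ u₁ - y, y⟫_ℂ).re ≤ 1.12 * t
        ∧ y ∈ Lemma2.Adm u₀
        ∧ (∀ m : ℕ, ‖⟪xStart u₀ u₁ - y, (T' ^ m) y⟫_ℂ‖ ≤ (⟪xStart u₀ u₁ - y, y⟫_ℂ).re)
        ∧ (∃ j, 1 ≤ j ∧ (⟪xStart u₀ u₁ - y, y⟫_ℂ).re ^ 4 < ‖⟪xStart u₀ u₁ - y, (T' ^ j) y⟫_ℂ‖)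
        ∧ 1 - Lemma2.gammaEps T' hT' u₀ (⟪xStart u₀ u₁ - y, y⟫_ℂ).re ≤ ‖s.a 0‖ ^ 2
        ∧ ‖s.a 0‖ ^ 2 ≤ 1 - (98 / 100 * 10 ^ 20 * (⟪xStart u₀ u₁ - y, y⟫_ℂ).re ^ 11) ^ 2
        ∧ (98 / 100 * 10 ^ 20 * (⟪xStart u₀ u₁ - y, y⟫_ℂ).re ^ 11) ^ 2 ≤ ‖L s.a‖ ^ 2
        ∧ ‖L s.a‖ ^ 2 ≤ Lemma2.gammaEps T' hT' u₀ (⟪xStart u₀ u₁ - y, y⟫_ℂ).re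
        ∧ (1 - Lemma2.gammaEps T' hT' u₀ (⟪xStart u₀ u₁ - y, y⟫_ℂ).re) * ‖s.a‖ ^ 2 ≤ ‖s.a 0‖ ^ 2 := by
  rcases standing_form hH T with hnis | ⟨T', hnorm, hdense, hinj, hsurj, htrans⟩
  · exact Or.inl hnis
  have hT' : ‖T'‖ < 1 := by rw [hnorm]; norm_num
  have hT20 : ‖T'‖ ≤ 1 / 10 ^ 20 := by rw [hnorm]; norm_num
  have hN : Nontrivial H := by
    by_contra h
    rw [not_nontrivial_iff_subsingleton] at h
    exact hH (Module.Finite.of_surjective (0 : (Fin 0 → ℂ) →ₗ[ℂ] H) fun x => ⟨0, Subsingleton.elim _ _⟩)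
  obtain ⟨u₀, hu₀⟩ := exists_norm_eq H zero_le_one
  obtain ⟨u₁, hu₁, h01, hη, h⟩ := exists_state_from_standing T' hT' hT20 hdense hsurj u₀ hu₀ ht0 ht1
  rcases h with hnis | ⟨y₀, y, s, hmin, hθ, hV, hε, hpos, hreal, hup, -, hAdm, h9, hI, h33a, h33b, h33c, h33d,
      h33e⟩
  · exact Or.inl (htrans hnis)
  · exact Or.inr ⟨T', hT', u₀, u₁, y₀, y, s, hnorm, hdense, hinj, hsurj, htrans, hu₀, hu₁, h01, hη, hmin, hθ, hV,
      hε, hpos, hreal, hup, hAdm, h9, hI, h33a, h33b, h33c, h33d, h33e⟩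

end PartAStart

end Literature.Analysis.OperatorTheory.Enflo2023
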